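import Literature.MeasureTheory.Group.InvariantQuotientOrbitalProd
import HarnessLib

/-!
# Orbital integrals along isomorphisms and over conjugate elements:
# `∫_{G'/C(eγ)} F(y (eγ) y⁻¹) = c ∫_{G/C(γ)} F(e(xγx⁻¹))` and `∫_{G/C(qγq⁻¹)} F = c ∫_{G/C(γ)} F`
(Gelbart, *Automorphic forms on adele groups* (1975), §10, pp. 154–155: the orbital integrals of
(10.14) and (10.15) are indexed by conjugacy classes and compared through `G_S = G'_S`; Folland
(1995), Thm. 2.49 for the uniqueness of invariant measures)

Topic `MeasureTheory/Group`; namespace `Literature.MeasureTheory.Group`; theorems only (no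
definition, no named fact, no instance visible to importers). Two bookkeeping facts used when the
geometric sides of two trace formulas are matched class by class (Gelbart (1975), pp. 154–155:
the terms of (10.14) for `G' = Dˣ` and of (10.15) for `G = GL₂` are compared through the
identification `G'_S = G_S` away from the ramified places and the correspondence of conjugacy
classes), stated — as everywhere in this development — for arbitrary non-zero invariant measures
finite on compact sets, with the normalising constant existentially quantified but independent of
the integrand:

* `forall_apply_mem_centralizer_singleton_iff_of_eq`, `descConj_cosetCongr_apply` — for an
  isomorphism `e : G ≃* G'` with `e γ = γ'`: `e(C(γ)) = C(γ')`, and the orbital integrand of `F` at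
  `γ'` pulled back along `cosetCongr e : G ⧸ C(γ) → G' ⧸ C(γ')` is the orbital integrand of `F ∘ e` at `γ`;
* `exists_eq_smul_map_cosetCongr_centralizer` — **invariant measures correspond**: `μ' = c • (cosetCongr e)_* μ`,
  `c ≠ 0` (uniqueness on `G' ⧸ C(γ')`; centralisers are closed in Hausdorff groups);
* `exists_integral_descConj_eq_smul_integral_descConj_comp` — **orbital integrals along an
  isomorphism of topological groups**: one `c ≠ 0` with
  `∫_{G'/C(γ')} F(y γ' y⁻¹) dμ'(y) = c ∫_{G/C(γ)} F(e(x γ x⁻¹)) dμ(x)` for all complex `F`;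
* `descConj_comp_conj_eq_descConj_smul`, `exists_integral_descConj_eq_smul_integral_descConj_of_conj_eq`
  — **orbital integrals over conjugate elements agree up to the normalisation**: for `γ₂ = q γ₁ q⁻¹`,
  one `c ≠ 0` with `∫_{G/C(γ₂)} F(y γ₂ y⁻¹) dμ₂ = c ∫_{G/C(γ₁)} F(x γ₁ x⁻¹) dμ₁` for all complex `F`
  (transport along the inner automorphism, then invariance of `μ₁` under `x ↦ q x`);
* `exists_integral_descConj_eq_smul_integral_descConj_comp_of_conj_eq` — **both at once**: for
  `e : G ≃* G'` bicontinuous and `q (e γ) q⁻¹ = γ₂` in `G'`, one `c ≠ 0` with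
  `∫_{G'/C(γ₂)} F(y γ₂ y⁻¹) dμ₂ = c ∫_{G/C(γ)} F(e(x γ x⁻¹)) dμ` for all complex `F` — the shape in
  which the away-from-`S` orbital integrals of matched classes `{γ'} ↔ {γ}` are compared
  (`G = G'^S`, `G' = G^S`, `e` the identification, `q` from the conjugacy of `e(γ')` and `γ`).

Part of the inline (D-0026) decomposition of
`Literature.NumberTheory.Automorphic.strong_multiplicity_one_quaternionUnits` (the comparison
(10.14) = (10.15) away from `S`).

## References

* S. Gelbart, *Automorphic forms on adele groups*, Ann. of Math. Studies 83 (1975), §10,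
  pp. 154–155 [Gelbart1975].
* G. B. Folland, *A Course in Abstract Harmonic Analysis* (1995), §2.6, Thm. 2.49 [Folland1995].
-/

noncomputable section

open MeasureTheory MeasureTheory.Measure Topology
open scoped NNReal ENNReal

namespace Literature.MeasureTheory.Group

/-! ### The orbital integrand along an isomorphism -/

section Algebra

variable {G G' : Type*} [Group G] [Group G'] (e : G ≃* G') {γ : G} {γ' : G'} (hγ : e γ = γ')

include hγ in
/-- **`e(C(γ)) = C(e γ)`**: the compatibility hypothesis of `cosetCongr e` for the pair of
centralisers. [folklore] -/
theorem forall_apply_mem_centralizer_singleton_iff_of_eq :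
    ∀ g : G, e g ∈ Subgroup.centralizer ({γ'} : Set G') ↔ g ∈ Subgroup.centralizer ({γ} : Set G) := fun g => by
  rw [← hγ]
  exact mulEquiv_apply_mem_centralizer_singleton_iff e γ g

/-- **The orbital integrand along an isomorphism**: the pull-back of `y C(γ') ↦ F(y γ' y⁻¹)` along
`x C(γ) ↦ (e x) C(γ')` is `x C(γ) ↦ F(e(x γ x⁻¹))`, the orbital integrand of `F ∘ e` at `γ`. [folklore] -/
theorem descConj_cosetCongr_apply {α : Type*} (F : G' → α) (x : G ⧸ Subgroup.centralizer ({γ} : Set G)) :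
    descConj γ' (Subgroup.centralizer ({γ'} : Set G')) (centralizer_comm γ') F
        (cosetCongr e _ _ (forall_apply_mem_centralizer_singleton_iff_of_eq e hγ) x) =
      descConj γ (Subgroup.centralizer ({γ} : Set G)) (centralizer_comm γ) (F ∘ e) x := by
  induction x using QuotientGroup.induction_on with
  | H g => rw [cosetCongr_mk, descConj_mk, descConj_mk, Function.comp_apply, map_mul, map_mul, map_inv, hγ]

/-- **The orbital integrand under an inner automorphism**: for `γ₂ = q γ₁ q⁻¹`,
`F(q (x γ₁ x⁻¹) q⁻¹) = F((qx) γ₁ (qx)⁻¹)`, i.e. the orbital integrand of `F ∘ conj(q)` at `γ₁` is the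
translate by `q` of the orbital integrand of `F` at `γ₁`. [folklore] -/
theorem descConj_comp_conj_eq_descConj_smul {α : Type*} (q γ₁ : G) (F : G → α)
    (x : G ⧸ Subgroup.centralizer ({γ₁} : Set G)) :
    descConj γ₁ (Subgroup.centralizer ({γ₁} : Set G)) (centralizer_comm γ₁) (F ∘ MulAut.conj q) x =
      descConj γ₁ (Subgroup.centralizer ({γ₁} : Set G)) (centralizer_comm γ₁) F (q • x) := by
  induction x using QuotientGroup.induction_on with
  | H g =>
    rw [MulAction.Quotient.smul_mk, descConj_mk, descConj_mk, Function.comp_apply, MulAut.conj_apply, smul_eq_mul]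
    congr 1
    group

/-- **The orbital integrand along `conj(q) ∘ e`**: for `e : G ≃* G'` and `q ∈ G'`,
`F(q e(x γ x⁻¹) q⁻¹) = F(e((q̃x) γ (q̃x)⁻¹))` with `q̃ = e⁻¹ q`, i.e. the orbital integrand of
`F ∘ conj(q) ∘ e` at `γ` is the translate by `e⁻¹ q` of that of `F ∘ e`. [folklore] -/
theorem descConj_comp_conj_comp_eq_descConj_comp_smul {α : Type*} (q : G') (γ : G) (F : G' → α)
    (x : G ⧸ Subgroup.centralizer ({γ} : Set G)) :
    descConj γ (Subgroup.centralizer ({γ} : Set G)) (centralizer_comm γ) (F ∘ (e.trans (MulAut.conj q))) x =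
      descConj γ (Subgroup.centralizer ({γ} : Set G)) (centralizer_comm γ) (F ∘ e) (e.symm q • x) := by
  induction x using QuotientGroup.induction_on with
  | H g =>
    rw [MulAction.Quotient.smul_mk, descConj_mk, descConj_mk, Function.comp_apply, Function.comp_apply,
      MulEquiv.trans_apply, MulAut.conj_apply, smul_eq_mul]
    simp only [map_mul, map_inv, MulEquiv.apply_symm_apply]
    congr 1
    group

end Algebra

/-! ### Invariant measures and orbital integrals along an isomorphism of topological groups -/

section Transport

variable {G G' : Type*} [Group G] [Group G'] [TopologicalSpace G] [TopologicalSpace G']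
  [IsTopologicalGroup G'] [LocallyCompactSpace G'] [SecondCountableTopology G'] [T2Space G']
  (e : G ≃* G') (he : Continuous e) (hes : Continuous e.symm) {γ : G} {γ' : G'} (hγ : e γ = γ')
  [MeasurableSpace (G ⧸ Subgroup.centralizer ({γ} : Set G))] [BorelSpace (G ⧸ Subgroup.centralizer ({γ} : Set G))]
  [MeasurableSpace (G' ⧸ Subgroup.centralizer ({γ'} : Set G'))]
  [BorelSpace (G' ⧸ Subgroup.centralizer ({γ'} : Set G'))]
  (μ : Measure (G ⧸ Subgroup.centralizer ({γ} : Set G)))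
  [SMulInvariantMeasure G (G ⧸ Subgroup.centralizer ({γ} : Set G)) μ] [IsFiniteMeasureOnCompacts μ]
  (μ' : Measure (G' ⧸ Subgroup.centralizer ({γ'} : Set G')))
  [SMulInvariantMeasure G' (G' ⧸ Subgroup.centralizer ({γ'} : Set G')) μ'] [IsFiniteMeasureOnCompacts μ']

include he hes in
/-- **Invariant measures on `G ⧸ C(γ)` and `G' ⧸ C(e γ)` correspond**: for a bicontinuous
isomorphism `e : G ≃* G'` with `e γ = γ'` (`G'` locally compact, second countable, Hausdorff) and
non-zero invariant measures `μ`, `μ'` finite on compact sets, `μ' = c • (cosetCongr e)_* μ` with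
`c ≠ 0` (the transported measure is invariant, finite on compact sets and non-zero; uniqueness on
`G' ⧸ C(γ')`, the centraliser being closed). [cite: Folland1995, Thm. 2.49] -/
theorem exists_eq_smul_map_cosetCongr_centralizer (hμ : μ ≠ 0) (hμ' : μ' ≠ 0) :
    ∃ c : ℝ≥0, c ≠ 0 ∧ μ' = c • Measure.map (cosetCongr e _ _ (forall_apply_mem_centralizer_singleton_iff_of_eq e hγ)) μ := by
  letI : MeasurableSpace G' := borel G'
  haveI : BorelSpace G' := ⟨rfl⟩
  haveI : IsClosed ((Subgroup.centralizer ({γ'} : Set G') : Subgroup G') : Set G') := Set.isClosed_centralizer _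
  set ψ := cosetCongrHomeomorph e _ _ (forall_apply_mem_centralizer_singleton_iff_of_eq e hγ) he hes with hψ
  have hψc : (cosetCongr e _ _ (forall_apply_mem_centralizer_singleton_iff_of_eq e hγ) :
      G ⧸ Subgroup.centralizer ({γ} : Set G) → G' ⧸ Subgroup.centralizer ({γ'} : Set G')) = ψ := rfl
  haveI : SMulInvariantMeasure G' _ (Measure.map (cosetCongr e _ _ (forall_apply_mem_centralizer_singleton_iff_of_eq e hγ)) μ) :=
    smulInvariantMeasure_map_cosetCongr_of_smulInvariant e he _ _ _ μ
  haveI : IsFiniteMeasureOnCompacts (Measure.map (cosetCongr e _ _ (forall_apply_mem_centralizer_singleton_iff_of_eq e hγ)) μ) := by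
    rw [hψc]
    exact IsFiniteMeasureOnCompacts.map μ ψ
  have hne : Measure.map (cosetCongr e _ _ (forall_apply_mem_centralizer_singleton_iff_of_eq e hγ)) μ ≠ 0 := by
    rw [hψc, Ne, Measure.map_eq_zero_iff ψ.measurable.aemeasurable]
    exact hμ
  exact smulInvariantMeasure_quotient_unique_ne_zero (Subgroup.centralizer ({γ'} : Set G')) μ' _ hμ' hne

include he hes hγ in
/-- **Orbital integrals along an isomorphism of topological groups**: with `e`, `γ' = e γ`, `μ`,
`μ'` as above there is ONE `c ≠ 0` such that for every complex `F` on `G'`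
`∫_{G'/C(γ')} F(y γ' y⁻¹) dμ'(y) = c ∫_{G/C(γ)} F(e(x γ x⁻¹)) dμ(x)`
(no integrability needed: both sides use the same convention for divergent integrals).
Gelbart (1975), p. 155: the orbital integrals away from `S` in (10.14) and (10.15) are identified
through `G'_S = G_S`. [cite: Gelbart1975, p. 155] [cite: Folland1995, Thm. 2.49] -/
theorem exists_integral_descConj_eq_smul_integral_descConj_comp (hμ : μ ≠ 0) (hμ' : μ' ≠ 0) :
    ∃ c : ℝ≥0, c ≠ 0 ∧ ∀ F : G' → ℂ,
      ∫ y, descConj γ' (Subgroup.centralizer ({γ'} : Set G')) (centralizer_comm γ') F y ∂μ' =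
        c • ∫ x, descConj γ (Subgroup.centralizer ({γ} : Set G)) (centralizer_comm γ) (F ∘ e) x ∂μ := by
  obtain ⟨c, hc0, hc⟩ := exists_eq_smul_map_cosetCongr_centralizer e he hes hγ μ μ' hμ hμ'
  refine ⟨c, hc0, fun F => ?_⟩
  set ψ := cosetCongrHomeomorph e _ _ (forall_apply_mem_centralizer_singleton_iff_of_eq e hγ) he hes with hψ
  have hψc : (cosetCongr e _ _ (forall_apply_mem_centralizer_singleton_iff_of_eq e hγ) :
      G ⧸ Subgroup.centralizer ({γ} : Set G) → G' ⧸ Subgroup.centralizer ({γ'} : Set G')) = ψ := rfl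
  rw [hc, integral_smul_nnreal_measure, hψc, ← Homeomorph.toMeasurableEquiv_coe ψ, integral_map_equiv]
  congr 1
  refine integral_congr_ae (Filter.Eventually.of_forall fun x => ?_)
  exact descConj_cosetCongr_apply e hγ F x

end Transport

/-! ### Orbital integrals over conjugate elements -/

section Conj

variable {G : Type*} [Group G] [TopologicalSpace G] [IsTopologicalGroup G] [LocallyCompactSpace G]
  [SecondCountableTopology G] [T2Space G] {γ₁ γ₂ : G} (q : G) (hq : q * γ₁ * q⁻¹ = γ₂)
  [MeasurableSpace (G ⧸ Subgroup.centralizer ({γ₁} : Set G))] [BorelSpace (G ⧸ Subgroup.centralizer ({γ₁} : Set G))]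
  [MeasurableSpace (G ⧸ Subgroup.centralizer ({γ₂} : Set G))] [BorelSpace (G ⧸ Subgroup.centralizer ({γ₂} : Set G))]
  (μ₁ : Measure (G ⧸ Subgroup.centralizer ({γ₁} : Set G)))
  [SMulInvariantMeasure G (G ⧸ Subgroup.centralizer ({γ₁} : Set G)) μ₁] [IsFiniteMeasureOnCompacts μ₁]
  (μ₂ : Measure (G ⧸ Subgroup.centralizer ({γ₂} : Set G)))
  [SMulInvariantMeasure G (G ⧸ Subgroup.centralizer ({γ₂} : Set G)) μ₂] [IsFiniteMeasureOnCompacts μ₂]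

include hq in
/-- **Orbital integrals over conjugate elements agree up to the normalisation of the invariant
measures**: for `γ₂ = q γ₁ q⁻¹` in a second countable locally compact Hausdorff group and non-zero
invariant measures `μ_i` on `G ⧸ C(γ_i)` finite on compact sets there is ONE `c ≠ 0` with
`∫_{G/C(γ₂)} F(y γ₂ y⁻¹) dμ₂ = c ∫_{G/C(γ₁)} F(x γ₁ x⁻¹) dμ₁` for all complex `F` (transport along the
inner automorphism `conj(q)`, which maps `γ₁ ↦ γ₂` and `C(γ₁) ↦ C(γ₂)`, then invariance of `μ₁` under
`x ↦ q x`). This is why the terms of (10.14)/(10.15) depend only on the conjugacy class `{γ}`.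
[cite: Gelbart1975, p. 154 (10.14)] [cite: Folland1995, Thm. 2.49] -/
theorem exists_integral_descConj_eq_smul_integral_descConj_of_conj_eq (hμ₁ : μ₁ ≠ 0) (hμ₂ : μ₂ ≠ 0) :
    ∃ c : ℝ≥0, c ≠ 0 ∧ ∀ F : G → ℂ,
      ∫ y, descConj γ₂ (Subgroup.centralizer ({γ₂} : Set G)) (centralizer_comm γ₂) F y ∂μ₂ =
        c • ∫ x, descConj γ₁ (Subgroup.centralizer ({γ₁} : Set G)) (centralizer_comm γ₁) F x ∂μ₁ := by
  set e : G ≃* G := MulAut.conj q with he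
  have hec : Continuous e := (continuous_const.mul continuous_id).mul continuous_const
  have hes : Continuous e.symm := (continuous_const.mul continuous_id).mul continuous_const
  have hγ : e γ₁ = γ₂ := by rw [← hq]; rfl
  obtain ⟨c, hc0, hc⟩ := exists_integral_descConj_eq_smul_integral_descConj_comp e hec hes hγ μ₁ μ₂ hμ₁ hμ₂
  refine ⟨c, hc0, fun F => ?_⟩
  rw [hc F]
  congr 1
  have h1 : ∀ x, descConj γ₁ (Subgroup.centralizer ({γ₁} : Set G)) (centralizer_comm γ₁) (F ∘ e) x =
      descConj γ₁ (Subgroup.centralizer ({γ₁} : Set G)) (centralizer_comm γ₁) F (q • x) := fun x =>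
    descConj_comp_conj_eq_descConj_smul q γ₁ F x
  simp_rw [h1]
  exact integral_smul_eq_self _

end Conj

/-! ### Both at once: along an isomorphism, up to conjugacy in the target -/

section TransportConj

variable {G G' : Type*} [Group G] [Group G'] [TopologicalSpace G] [TopologicalSpace G']
  [IsTopologicalGroup G] [IsTopologicalGroup G'] [LocallyCompactSpace G'] [SecondCountableTopology G'] [T2Space G']
  (e : G ≃* G') (he : Continuous e) (hes : Continuous e.symm) {γ : G} {γ₂ : G'} (q : G')
  (hq : q * e γ * q⁻¹ = γ₂)
  [MeasurableSpace (G ⧸ Subgroup.centralizer ({γ} : Set G))] [BorelSpace (G ⧸ Subgroup.centralizer ({γ} : Set G))]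
  [MeasurableSpace (G' ⧸ Subgroup.centralizer ({γ₂} : Set G'))]
  [BorelSpace (G' ⧸ Subgroup.centralizer ({γ₂} : Set G'))]
  (μ : Measure (G ⧸ Subgroup.centralizer ({γ} : Set G)))
  [SMulInvariantMeasure G (G ⧸ Subgroup.centralizer ({γ} : Set G)) μ] [IsFiniteMeasureOnCompacts μ]
  (μ₂ : Measure (G' ⧸ Subgroup.centralizer ({γ₂} : Set G')))
  [SMulInvariantMeasure G' (G' ⧸ Subgroup.centralizer ({γ₂} : Set G')) μ₂] [IsFiniteMeasureOnCompacts μ₂]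

include he hes hq in
/-- **Orbital integrals along an isomorphism, up to conjugacy in the target**: for a bicontinuous
`e : G ≃* G'` (`G'` locally compact, second countable, Hausdorff), `γ ∈ G`, `q, γ₂ ∈ G'` with
`q e(γ) q⁻¹ = γ₂`, and non-zero invariant measures `μ` on `G ⧸ C(γ)`, `μ₂` on `G' ⧸ C(γ₂)` finite on
compact sets, there is ONE `c ≠ 0` with
`∫_{G'/C(γ₂)} F(y γ₂ y⁻¹) dμ₂(y) = c ∫_{G/C(γ)} F(e(x γ x⁻¹)) dμ(x)` for every complex `F`
(transport along `conj(q) ∘ e`, then invariance of `μ` under `x ↦ (e⁻¹ q) x`). Gelbart (1975),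
pp. 154–155: the orbital integrals `∫_{B_S \ G_S} f * f^*(x⁻¹ γ x) dx` of (10.14) (for `G'`, through
`G'_S = G_S`) and of (10.15) are the same for matched classes. [cite: Gelbart1975, pp. 154–155] [cite: Folland1995, Thm. 2.49] -/
theorem exists_integral_descConj_eq_smul_integral_descConj_comp_of_conj_eq (hμ : μ ≠ 0) (hμ₂ : μ₂ ≠ 0) :
    ∃ c : ℝ≥0, c ≠ 0 ∧ ∀ F : G' → ℂ,
      ∫ y, descConj γ₂ (Subgroup.centralizer ({γ₂} : Set G')) (centralizer_comm γ₂) F y ∂μ₂ =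
        c • ∫ x, descConj γ (Subgroup.centralizer ({γ} : Set G)) (centralizer_comm γ) (F ∘ e) x ∂μ := by
  set e₂ : G ≃* G' := e.trans (MulAut.conj q) with he₂
  have hec : Continuous e₂ := ((continuous_const.mul continuous_id).mul continuous_const).comp he
  have hes₂ : Continuous e₂.symm := hes.comp ((continuous_const.mul continuous_id).mul continuous_const)
  have hγ : e₂ γ = γ₂ := by rw [← hq]; rfl
  obtain ⟨c, hc0, hc⟩ := exists_integral_descConj_eq_smul_integral_descConj_comp e₂ hec hes₂ hγ μ μ₂ hμ hμ₂
  refine ⟨c, hc0, fun F => ?_⟩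
  rw [hc F]
  congr 1
  have h1 : ∀ x, descConj γ (Subgroup.centralizer ({γ} : Set G)) (centralizer_comm γ) (F ∘ e₂) x =
      descConj γ (Subgroup.centralizer ({γ} : Set G)) (centralizer_comm γ) (F ∘ e) (e.symm q • x) := fun x =>
    descConj_comp_conj_comp_eq_descConj_comp_smul e q γ F x
  simp_rw [h1]
  exact integral_smul_eq_self _

end TransportConj

end Literature.MeasureTheory.Group
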